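import Summits.HubbardSuperconductivity.HubbardLadder.PairCorrWindowUniformTargets
import Summits.HubbardSuperconductivity.HubbardLadder.R3R4SumRule
import Literature.MathematicalPhysics.QuantumLattice.PairFieldYangCeiling
import HarnessLib

/-!
# Rungs R3/R4 — uniform-in-`L` CEILINGS on the `d`-wave order parameter from finitely many
translation-invariant UPPER certificates (block Cauchy–Schwarz)

HONEST FRAMING (page 1): ladder R1–R4 with certified numbers; no claim on H/H₀. This file proves
EDGES only. No certificate of the kind it consumes has been computed; the ceilings it can produce
from the affordable window classes are expected to be WEAK (of the order of the local pair density,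
orders of magnitude above the physical scale of the order parameter): they BOUND the R4 quantity from
above, they do not decide order versus disorder (that is `VanishingPairFieldCeilingCert`, which no
finite family of windows supplies — R4-MEMO §8.5).

What is proved.
* §1 **Block Cauchy–Schwarz** (every state, every side): for every finite block `S ⊂ ℤ²`,
  `|S|² · p_d(L; ψ) ≤ Σ_{s ∈ S} Σ_{s' ∈ S} P̄_d(L, s' − s; ψ)` — the pair-field density (the R4 order
  parameter; `= dWaveOrderParamSq` on even sides, `Links.dWaveOrderParamSq_eq_pairFieldDensity`) is
  dominated by a FIXED rational combination of the translation-averaged correlators (the R3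
  observable `avgPairCorr`) at the finitely many displacements of `S − S`. `S = {0}`:
  `p_d(L; ψ) ≤ P̄_d(L, 0; ψ)`, the local pair density.
* §2 `UniformPairFieldCeilingCert H N` — a number `ε` with `p_d(L; ψ) ≤ ε` for every unit ground
  state of the sector `(N L, S^z = 0)` of `H L` on every even side `L ≥ L₀` — and its consequences for
  every admissible ground-state sequence: `∀ᶠ k, dWaveOrderParamSq ψ k ≤ ε` and `limsup ≤ ε`.
* §3 PRODUCERS. One translation-invariant upper certificate `PairWindowCertTT' t t' U r (-1)` (tree,
  `PairCorrWindowUniform`) with density offset `ν = (1 − δ)/2` and energy ceiling above the TL energy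
  density gives, for every `a > −q`, the uniform row `P̄_d(L, r; ψ) ≤ a` over every unit sector ground
  state of every large torus (`UpperRowCertTT'.avgPairCorr_le_eventually`); a BLOCK of such rows
  (one per ordered pair of `S`) gives a `UniformPairFieldCeilingCert` with
  `ε = |S|⁻² Σ_{s,s'} a(s, s')` (`UniformPairFieldCeilingCert.ofRows`).
* §4 The headline data type at `(t, t', U) = (1, t', 8)`, doping `1/8`: `R4CeilingBlockCert t'`
  (`|S|²` upper certificates, `ν = 7/16`, energy ceilings above `e(1, t', 8, 7/8)`) ⇒
  `limsup_k dWaveOrderParamSq ψ k ≤ |S|⁻² Σ_{s,s'} (−q_{s,s'})` for EVERY admissible ground-state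
  sequence of `hubbardTorusTT' L 1 t' 8` — and, at `t' = 0`, of the pure model under the hypotheses
  of `NoDWaveOrderPureU8Eighth` verbatim (`hubbardTorusTT'_zero`).
* §5 The edge to the typed target H⁻: blocks of EVERY size (`E ≤ ε` for every `ε > 0`) prove
  `NoDWaveOrderPureU8Eighth` — the honest statement of what the family could decide in the limit;
  one block only bounds.
* §6 RUNG 0, CERTIFICATE-FREE (the benchmark): Yang's bound on the largest eigenvalue of the
  two-particle density matrix (tree, `re_expect_pairField_dWave_conjTranspose_mul_le_yang` of
  `Literature…PairFieldYangCeiling`) gives `p_d(L; ψ) ≤ 2N(2L² − N + 2)/L⁴` for every unit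
  `N`-particle vector, hence `≤ 2(1 − δ²) + 4(1 − δ)/L²` at `N = electronNumber δ L`, `δ ∈ [0, 1]`;
  packaged as a `UniformPairFieldCeilingCert H (electronNumber δ)` with `ε = 2(1 − δ²) + g` for EVERY
  family `H` and every `g > 0` (`UniformPairFieldCeilingCert.exists_yang`), so
  `limsup_k dWaveOrderParamSq ψ k ≤ 2(1 − δ²)` for every admissible sequence and every `H`
  (`limsup_dWaveOrderParamSq_le_yang`); at `δ = 1/8`: `≤ 63/32` (`…_yang_eighth`). A certificate-based
  ceiling of §3–§4 carries information about the Hamiltonian only if its constant is `< 63/32`; the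
  physical order parameter is about three orders of magnitude smaller (label: from print).
* §7 ONE CERTIFICATE PER BLOCK (the engines' `pair_dd` LIST grammar): `PairListCertTT' t t' U n λ r` —
  the translation-invariant window certificate of `PairWindowCertTT'` with the LIST objective
  `Σ_i λ_i Δ_0† Δ_{r_i}` — is sound uniformly in `L` (`PairListCertTT'.bound_le`:
  `q + (Σμ)(nh/L² − ν) ≤ Σ_i λ_i P̄_d(L, r_i; ψ)` for every unit sector ground state, from the tree's
  general theorem `re_orbitState_ge_of_window_certificate_d4_TT'_groundState` by linearity); an UPPER
  list certificate for a list representing the displacement multiset of a block `S`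
  (`UpperBlockListCertTT'`, field `hrep`; `hrep_single`, `hrep_pair` show the obligation is routine)
  gives the ceiling `E = −q/|S|²` (`exists_ceilingCert`, `limsup_dWaveOrderParamSq_le`); headline data
  type `R4CeilingListCert t'` at `(1, t', 8)`, doping `1/8`, with the `t–t'` and pure-model
  consequences and the edge `noDWaveOrderPureU8Eighth_of_ceilingListCerts`; a single-row upper
  certificate at `r = 0` IS the list certificate of `S = {0}` (`PairListCertTT'.ofSingle`). So a block
  ceiling costs ONE solve, not `|S − S|`.

Every hypothesis is a binder or a structure field; nothing about the Hubbard ground state is assumed.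

FILE SPLIT (gate `lint.size`, ≤ 400 lines per Theorems file; split by the filer, declarations byte-identical):
this file = §1 (block Cauchy–Schwarz) + §2 (`UniformPairFieldCeilingCert`); §3–§6 (producers, the
`R4CeilingBlockCert` data type, the edge to H⁻, the Yang rung 0) = `PairFieldCeilingUniformRows.lean`;
§7 list certificates = `PairFieldCeilingListCert.lean` (`PairListCertTT'`, `ofSingle`) and
`PairFieldCeilingListBlocks.lean` (`UpperBlockListCertTT'`, `R4CeilingListCert`, the list edge).
-/

namespace Summit.HubbardSuperconductivity.HubbardLadder

open Matrix Finset Filter Literature.Probability.LatticeModels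
  Literature.MathematicalPhysics.QuantumLattice
open Literature.MathematicalPhysics.QuantumLattice.ThermodynamicLimit
open Literature.MathematicalPhysics.QuantumManyBody.StateRelaxation
open scoped ComplexOrder Topology

noncomputable section

/-! ## §1 Block Cauchy–Schwarz: `|S|² p_d(L) ≤ Σ_{s,s' ∈ S} P̄_d(L, s' − s)` -/

section BlockCS

variable (S : Finset (Site 2)) (L : ℕ) [NeZero L]

/-- The block pair operator `B_x(S) = Σ_{s ∈ S} Δ_{x+s}` (the `d`-wave local pairs translated over the
block `S`, reduced mod `L`). [folklore] -/
def blockPair (x : TorusSite 2 L) :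
    Matrix (Finset (Orb (FermionTorus 2 L))) (Finset (Orb (FermionTorus 2 L))) ℂ :=
  ∑ s ∈ S, localPair dWaveFormFactor L (x + Torus.proj L s)

/-- `Σ_x B_x(S) = |S| · Δ` (each `Δ_y` is counted once per `s ∈ S`). [folklore] -/
theorem sum_blockPair :
    ∑ x : TorusSite 2 L, blockPair S L x = #S • pairField dWaveFormFactor L := by
  unfold blockPair pairField
  rw [Finset.sum_comm]
  calc ∑ s ∈ S, ∑ x : TorusSite 2 L, localPair dWaveFormFactor L (x + Torus.proj L s)
      = ∑ s ∈ S, ∑ y : TorusSite 2 L, localPair dWaveFormFactor L y :=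
        Finset.sum_congr rfl fun s _ =>
          Fintype.sum_equiv (Equiv.addRight (Torus.proj L s)) _ _ fun _ => rfl
    _ = #S • ∑ y : TorusSite 2 L, localPair dWaveFormFactor L y := Finset.sum_const _

omit [NeZero L] in
/-- `Torus.proj` is additive: the projection of a difference of sites. [folklore] -/
private theorem proj_sub_eq (s s' : Site 2) :
    Torus.proj L (s' - s) = Torus.proj L s' - Torus.proj L s := by
  funext i; simp [Torus.proj]

/-- `‖B_x(S) ψ‖² = Σ_{s, s' ∈ S} re ⟨ψ, Δ_{x+s}† Δ_{x+s'} ψ⟩`. [folklore] -/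
theorem norm_toLp_blockPair_mulVec_sq (x : TorusSite 2 L) (ψ : Fock (Orb (FermionTorus 2 L))) :
    ‖(WithLp.toLp 2 (blockPair S L x *ᵥ ψ) : EuclideanSpace ℂ (Finset (Orb (FermionTorus 2 L))))‖ ^ 2 =
      ∑ s ∈ S, ∑ s' ∈ S, (expect ((localPair dWaveFormFactor L (x + Torus.proj L s))ᴴ *
          localPair dWaveFormFactor L (x + Torus.proj L s')) ψ).re := by
  rw [norm_toLp_sq_eq_re, ← PosSemidefTrace.expect_conjTranspose_mul, blockPair, conjTranspose_sum,
    Finset.sum_mul, expect_sum, Complex.re_sum]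
  refine Finset.sum_congr rfl fun s _ => ?_
  rw [Finset.mul_sum, expect_sum, Complex.re_sum]

/-- Translation reindexing of the two-point sum:
`Σ_x re ⟨Δ_{x+s}† Δ_{x+s'}⟩ = Σ_y re ⟨Δ_y† Δ_{y+(s'−s)}⟩`. [folklore] -/
theorem sum_re_expect_translate (s s' : Site 2) (ψ : Fock (Orb (FermionTorus 2 L))) :
    ∑ x : TorusSite 2 L, (expect ((localPair dWaveFormFactor L (x + Torus.proj L s))ᴴ *
        localPair dWaveFormFactor L (x + Torus.proj L s')) ψ).re =
      ∑ y : TorusSite 2 L, (expect ((localPair dWaveFormFactor L y)ᴴ *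
        localPair dWaveFormFactor L (y + Torus.proj L (s' - s))) ψ).re := by
  refine Fintype.sum_equiv (Equiv.addRight (Torus.proj L s)) _ _ fun x => ?_
  simp only [Equiv.coe_addRight, proj_sub_eq]
  rw [show x + Torus.proj L s + (Torus.proj L s' - Torus.proj L s) = x + Torus.proj L s' by abel]

end BlockCS

/-- **Block Cauchy–Schwarz.** For every finite block `S ⊂ ℤ²`, every side `L` and EVERY state `ψ`:
`|S|² · p_d(L; ψ) ≤ Σ_{s ∈ S} Σ_{s' ∈ S} P̄_d(L, s' − s; ψ)`. (`|S| Δ = Σ_x B_x(S)`, hence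
`|S| ‖Δψ‖ ≤ Σ_x ‖B_x ψ‖`; `(Σ_x ‖B_x ψ‖)² ≤ L² Σ_x ‖B_x ψ‖²` (Cauchy–Schwarz in `ℝ^{L²}`); and
`Σ_x ‖B_x ψ‖² = L² Σ_{s,s'} P̄_d(L, s' − s; ψ)` by translation averaging.) Both sides are the junk
value `0` at side `0`. [folklore] -/
theorem card_sq_mul_pairFieldDensity_le_sum_avgPairCorr (S : Finset (Site 2)) :
    ∀ (L : ℕ) (ψ : Fock (Orb (FermionTorus 2 L))),
      (#S : ℝ) ^ 2 * pairFieldDensity L ψ ≤ ∑ s ∈ S, ∑ s' ∈ S, avgPairCorr L (s' - s) ψ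
  | 0, _ => by simp [pairFieldDensity, avgPairCorr]
  | m + 1, ψ => by
    set T : ℝ := ∑ s ∈ S, ∑ s' ∈ S, avgPairCorr (m + 1) (s' - s) ψ with hT
    set V : TorusSite 2 (m + 1) → EuclideanSpace ℂ (Finset (Orb (FermionTorus 2 (m + 1)))) :=
      fun x => WithLp.toLp 2 (blockPair S (m + 1) x *ᵥ ψ) with hV
    set w : EuclideanSpace ℂ (Finset (Orb (FermionTorus 2 (m + 1)))) :=
      WithLp.toLp 2 (pairField dWaveFormFactor (m + 1) *ᵥ ψ) with hw
    have hL2 : (0 : ℝ) < ((m + 1 : ℕ) : ℝ) ^ 2 := by positivity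
    -- (a) `|S| ‖Δψ‖ ≤ Σ_x ‖B_x ψ‖`
    have ha : (#S : ℝ) * ‖w‖ ≤ ∑ x, ‖V x‖ := by
      have hsum : ∑ x, V x = (#S : ℂ) • w := by
        simp only [hV, hw]
        rw [← WithLp.toLp_sum, ← Matrix.sum_mulVec, sum_blockPair, ← Nat.cast_smul_eq_nsmul ℂ,
          Matrix.smul_mulVec, WithLp.toLp_smul]
      calc (#S : ℝ) * ‖w‖ = ‖(#S : ℂ) • w‖ := by rw [norm_smul, Complex.norm_natCast]
        _ = ‖∑ x, V x‖ := by rw [hsum]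
        _ ≤ ∑ x, ‖V x‖ := norm_sum_le _ _
    -- (b) square, and Cauchy–Schwarz in `ℝ^{L²}`
    have hcard : (#(Finset.univ : Finset (TorusSite 2 (m + 1))) : ℝ) = ((m + 1 : ℕ) : ℝ) ^ 2 := by
      rw [Finset.card_univ, Fintype.card_pi, prod_const, ZMod.card, card_univ, Fintype.card_fin]
      push_cast
      ring
    have hb : (#S : ℝ) ^ 2 * ‖w‖ ^ 2 ≤ ((m + 1 : ℕ) : ℝ) ^ 2 * ∑ x, ‖V x‖ ^ 2 := by
      have h1 : ((#S : ℝ) * ‖w‖) ^ 2 ≤ (∑ x, ‖V x‖) ^ 2 := pow_le_pow_left₀ (by positivity) ha 2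
      have h2 : (∑ x, ‖V x‖) ^ 2 ≤ #(Finset.univ : Finset (TorusSite 2 (m + 1))) * ∑ x, ‖V x‖ ^ 2 :=
        sq_sum_le_card_mul_sum_sq
      rw [hcard] at h2
      rw [mul_pow] at h1
      exact h1.trans h2
    -- (c) `Σ_x ‖B_x ψ‖² = L² · T` by translation averaging
    have hc : ∑ x, ‖V x‖ ^ 2 = ((m + 1 : ℕ) : ℝ) ^ 2 * T := by
      simp only [hV, norm_toLp_blockPair_mulVec_sq]
      rw [Finset.sum_comm, hT, Finset.mul_sum]
      refine Finset.sum_congr rfl fun s _ => ?_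
      rw [Finset.sum_comm, Finset.mul_sum]
      refine Finset.sum_congr rfl fun s' _ => ?_
      rw [sum_re_expect_translate, avgPairCorr_succ, mul_div_cancel₀ _ hL2.ne']
    -- (d) assemble: `p_d = ‖Δψ‖² / L⁴`
    have hw2 : ‖w‖ ^ 2 =
        (expect ((pairField dWaveFormFactor (m + 1))ᴴ * pairField dWaveFormFactor (m + 1)) ψ).re := by
      rw [hw, norm_toLp_sq_eq_re, ← PosSemidefTrace.expect_conjTranspose_mul]
    rw [pairFieldDensity_succ, ← hw2, ← mul_div_assoc, div_le_iff₀ (by positivity)]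
    rw [hc] at hb
    calc (#S : ℝ) ^ 2 * ‖w‖ ^ 2 ≤ ((m + 1 : ℕ) : ℝ) ^ 2 * (((m + 1 : ℕ) : ℝ) ^ 2 * T) := hb
      _ = T * ((m + 1 : ℕ) : ℝ) ^ 4 := by ring

/-- Block Cauchy–Schwarz, divided form: for a nonempty block,
`p_d(L; ψ) ≤ |S|⁻² Σ_{s,s' ∈ S} P̄_d(L, s' − s; ψ)`. [folklore] -/
theorem pairFieldDensity_le_blockAvg {S : Finset (Site 2)} (hS : S.Nonempty) (L : ℕ)
    (ψ : Fock (Orb (FermionTorus 2 L))) :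
    pairFieldDensity L ψ ≤ (∑ s ∈ S, ∑ s' ∈ S, avgPairCorr L (s' - s) ψ) / (#S : ℝ) ^ 2 := by
  have hS' : (0 : ℝ) < (#S : ℝ) ^ 2 := by
    have : 0 < #S := Finset.card_pos.2 hS
    positivity
  rw [le_div_iff₀ hS', mul_comm]
  exact card_sq_mul_pairFieldDensity_le_sum_avgPairCorr S L ψ

/-- `S = {0}`: **the order parameter is at most the local pair density**, `p_d(L; ψ) ≤ P̄_d(L, 0; ψ)`,
for every side and every state. [folklore] -/
theorem pairFieldDensity_le_avgPairCorr_zero (L : ℕ) (ψ : Fock (Orb (FermionTorus 2 L))) :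
    pairFieldDensity L ψ ≤ avgPairCorr L 0 ψ := by
  have h := card_sq_mul_pairFieldDensity_le_sum_avgPairCorr {0} L ψ
  simpa using h

/-! ## §2 Uniform ceiling certificates and the order-parameter sequence -/

/-- **R4-format CEILING certificate (quantitative, not vanishing).** A number `ε` bounding the
pair-field density of EVERY unit ground state of the sector `(N L, S^z = 0)` of `H L` on every even
side `L ≥ L₀`. Compare `VanishingPairFieldCeilingCert` (`u L → 0`, decides R4⁻) — this one only
BOUNDS the order parameter. [cite: QinEtAl2020, §III.B] -/
structure UniformPairFieldCeilingCert (H : TorusHamiltonianFamily) (N : ℕ → ℕ) where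
  /-- the ceiling -/
  ε : ℝ
  /-- the side from which it holds -/
  L₀ : ℕ
  bound : ∀ L, L₀ ≤ L → Even L → ∀ ψ : Fock (Orb (FermionTorus 2 L)), star ψ ⬝ᵥ ψ = 1 →
    IsGroundStateInSector (H L) (N L) 0 ψ → pairFieldDensity L ψ ≤ ε

namespace UniformPairFieldCeilingCert

variable {H : TorusHamiltonianFamily} {N : ℕ → ℕ}

/-- Under a ceiling certificate, the finite-volume order parameter of every admissible ground-state
sequence is eventually `≤ ε`. [cite: Scalapino1995, §2 eq. (2.4)] -/
theorem eventually_dWaveOrderParamSq_le (cert : UniformPairFieldCeilingCert H N)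
    (ψ : ∀ L, Fock (Orb (FermionTorus 2 L)))
    (hψ : ∀ L, Even L → star (ψ L) ⬝ᵥ ψ L = 1 ∧ IsGroundStateInSector (H L) (N L) 0 (ψ L)) :
    ∀ᶠ k in atTop, dWaveOrderParamSq ψ k ≤ cert.ε := by
  refine eventually_atTop.2 ⟨cert.L₀ + 1, fun k hk => ?_⟩
  rw [dWaveOrderParamSq_eq_pairFieldDensity ψ (by omega)]
  exact cert.bound (2 * k) (by omega) (even_two_mul k) _ (hψ _ (even_two_mul k)).1
    (hψ _ (even_two_mul k)).2

/-- Under a ceiling certificate, `limsup_k dWaveOrderParamSq ψ k ≤ ε` for every admissible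
ground-state sequence. [cite: Scalapino1995, §2 eq. (2.4)] -/
theorem limsup_dWaveOrderParamSq_le (cert : UniformPairFieldCeilingCert H N)
    (ψ : ∀ L, Fock (Orb (FermionTorus 2 L)))
    (hψ : ∀ L, Even L → star (ψ L) ⬝ᵥ ψ L = 1 ∧ IsGroundStateInSector (H L) (N L) 0 (ψ L)) :
    limsup (dWaveOrderParamSq ψ) atTop ≤ cert.ε := by
  refine Filter.limsup_le_of_le ?_ (cert.eventually_dWaveOrderParamSq_le ψ hψ)
  refine Filter.isCoboundedUnder_le_of_eventually_le atTop (x := (0 : ℝ)) ?_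
  refine eventually_atTop.2 ⟨1, fun k hk => ?_⟩
  rw [dWaveOrderParamSq_eq_pairFieldDensity ψ hk]
  exact pairFieldDensity_nonneg _ _

/-- Weakening the ceiling. [folklore] -/
def mono (cert : UniformPairFieldCeilingCert H N) {ε' : ℝ} (h : cert.ε ≤ ε') :
    UniformPairFieldCeilingCert H N where
  ε := ε'
  L₀ := cert.L₀
  bound L hL hE ψ h1 hgs := (cert.bound L hL hE ψ h1 hgs).trans h

/-- **Ceilings of every size give R4⁻.** If for every `ε > 0` there is a uniform ceiling
certificate for `(H, N)` with constant `≤ ε`, the order parameter of every admissible ground-state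
sequence tends to `0` (squeeze with `pairFieldDensity_nonneg`). [cite: FriedliVelenik2017, §3.7.2
Definition 3.27] -/
theorem tendsto_zero_of_forall (h : ∀ ε > 0, ∃ cert : UniformPairFieldCeilingCert H N, cert.ε ≤ ε)
    (ψ : ∀ L, Fock (Orb (FermionTorus 2 L)))
    (hψ : ∀ L, Even L → star (ψ L) ⬝ᵥ ψ L = 1 ∧ IsGroundStateInSector (H L) (N L) 0 (ψ L)) :
    Tendsto (dWaveOrderParamSq ψ) atTop (𝓝 0) := by
  have h0 : ∀ᶠ k in atTop, 0 ≤ dWaveOrderParamSq ψ k :=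
    eventually_atTop.2 ⟨1, fun k hk => by
      rw [dWaveOrderParamSq_eq_pairFieldDensity ψ hk]; exact pairFieldDensity_nonneg _ _⟩
  refine tendsto_order.2 ⟨fun a ha => h0.mono fun k hk => ha.trans_le hk, fun b hb => ?_⟩
  obtain ⟨cert, hε⟩ := h (b / 2) (half_pos hb)
  exact (cert.eventually_dWaveOrderParamSq_le ψ hψ).mono fun k hk => by linarith

/-- **Ceiling from a block of uniform upper rows.** If for every ordered pair `(s, s')` of a nonempty
block `S` the row `P̄_d(L, s' − s; ψ) ≤ a s s'` holds over every unit sector ground state of every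
side `L ≥ L₁`, then `ε = |S|⁻² Σ_{s,s'} a s s'` is a uniform ceiling from `L₁` on (block
Cauchy–Schwarz). [folklore] -/
def ofRows {S : Finset (Site 2)} (hS : S.Nonempty) (a : Site 2 → Site 2 → ℝ) (L₁ : ℕ)
    (hrow : ∀ s ∈ S, ∀ s' ∈ S, ∀ L, L₁ ≤ L → Even L → ∀ ψ : Fock (Orb (FermionTorus 2 L)),
      star ψ ⬝ᵥ ψ = 1 → IsGroundStateInSector (H L) (N L) 0 ψ → avgPairCorr L (s' - s) ψ ≤ a s s') :
    UniformPairFieldCeilingCert H N where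
  ε := (∑ s ∈ S, ∑ s' ∈ S, a s s') / (#S : ℝ) ^ 2
  L₀ := L₁
  bound L hL hE ψ h1 hgs := by
    refine (pairFieldDensity_le_blockAvg hS L ψ).trans ?_
    gcongr with s hs s' hs'
    exact hrow s hs s' hs' L hL hE ψ h1 hgs

end UniformPairFieldCeilingCert

end

end Summit.HubbardSuperconductivity.HubbardLadder
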